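import Mathlib
import Summits.KontsevichZagierPeriods.Zeta5Search.WrappedDivisibilityUProof
import HarnessLib

/-!
# ζ(5) search — PROVED, computable, digit-free class bounds for `v_p(W(b))`, `v_p(U(b))`, `v_p(V(b))` at every window prime

Cell `pub-zeta5` (HONEST FRAMING: systematic search; no irrationality claim unless certified), typer seat
generation 8.  New CELL results (not cited facts): for the census's PROVED-denominator column, the analogues for the single
coefficients of what THEOREM LB (`casoratianClassBound_holds`) is for the Casoratian — valid for EVERY `b` in the
Brown–Zudilin polytope and every prime `p ≥ 5` with `p² > b₀ + 2`, with no hypothesis `H(s)`: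

* `wLB b p := min{ 1 [class with one pole], 3 + E_x [class with ≥ 2 poles], 0 [p > d+1] }` and
  **`wLB_le_padicValRat_coeffW`**: `v_p(W(b)) ≥ wLB(b,p)` (Theorem A/A′ on the `𝒦`-pieces, `p ∣ g_o − [o=2]`, `p² ∣ g_0`,
  moments for `Ω_p`);
* `uLB b p := min{ 1 [one pole], 5 + E_x [≥ 2 poles], 0 [4p > 2d+3] }` and **`uLB_le_padicValRat_coeffU`**: `v_p(U(b)) ≥ uLB(b,p)`
  (the `U`-residue split of `WrappedDivisibilityUProof`, weights `‖g⁽⁴⁾_o − [o=4]‖ ≤ p^{−max(4−o,1)}`);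
* **`vbMin_le_padicValRat_coeffV`**: `v_p(V(b)) ≥ VB(b,p)` (`vbMin`, the minimum of the `ν_x`; `classNuBound`).
For `p > b₀` these reduce to the landed big-prime statements ((W∞)/(U∞) and integrality).  Valuation bookkeeping; nothing about
irrationality.
-/

noncomputable section

open Finset

namespace Summit.KontsevichZagierPeriods.Zeta5Search.ClusterValuation

open Summit.KontsevichZagierPeriods.Zeta5Search.WedgeDictionary (coeffU coeffW coeffV pfData dOf)
open Summit.KontsevichZagierPeriods.Zeta5Search.CasoratianValuation (InPolytope)
open Summit.KontsevichZagierPeriods.Zeta5Search.PadicSeries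

/-! ### The computable bounds -/

/-- The class row list for a coefficient with single-pole value `1` and multipole value `s + E_x`. -/
def classRowList (b : ℕ → ℤ) (p : ℕ) (s : ℤ) : List ℤ :=
  (List.range p).filterMap fun x =>
    if classPoleCount b p x = 1 then some 1
    else if 2 ≤ classPoleCount b p x then some (s + classExp b p x) else none

/-- **`wLB(b,p)`** = `min{1 [single], 3 + E_x [multi], 0 [p > d+1]}` (`0` if there is no pole class at all). -/
def wLB (b : ℕ → ℤ) (p : ℕ) : ℤ :=
  ((classRowList b p 3 ++ (if dOf b + 1 < (p : ℤ) then [0] else [])).min?).getD 0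

/-- **`uLB(b,p)`** = `min{1 [single], 5 + E_x [multi], 0 [4p > 2d+3]}` (`0` if there is no pole class at all). -/
def uLB (b : ℕ → ℤ) (p : ℕ) : ℤ :=
  ((classRowList b p 5 ++ (if 2 * dOf b + 3 < 4 * (p : ℤ) then [0] else [])).min?).getD 0

variable {p : ℕ} [hp : Fact p.Prime]

omit hp in
/-- Reading the row list. -/
theorem mem_classRowList (b : ℕ → ℤ) (s : ℤ) {x : ℕ} (hx : x < p) {z : ℤ}
    (hz : (if classPoleCount b p x = 1 then some 1
      else if 2 ≤ classPoleCount b p x then some (s + classExp b p x) else none) = some z) :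
    z ∈ classRowList b p s :=
  List.mem_filterMap.2 ⟨x, List.mem_range.2 hx, hz⟩

omit hp in
/-- A generic reader: if `z` is in the list whose `min?` defines the bound, the bound is `≤ z`. -/
theorem getD_min_le {l : List ℤ} {z : ℤ} (hz : z ∈ l) : (l.min?).getD 0 ≤ z := by
  cases h : l.min? with
  | none => rw [List.min?_eq_none_iff] at h; rw [h] at hz; simp at hz
  | some m => simpa using (List.min?_eq_some_iff.1 h).2 z hz

/-! ### `U`: class pieces without `H(5)` -/

omit hp in
/-- `𝒦⁽⁴⁾_x = 0` for a class without poles. -/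
theorem classKU_eq_zero_of_noPole (b : ℕ → ℤ) (hb : InPolytope b) {x : ℕ} (h0 : classPoleCount b p x = 0) :
    classKU b p x = 0 := by
  unfold classKU
  refine sum_eq_zero fun q hq => sum_eq_zero fun o ho => ?_
  rw [pfData_eq_zero_of_netExp_nonneg b hb ((mem_classSet_iff b x q).1 hq).1 (netExp_nonneg_of_noPole b h0 hq)
    (mem_range.1 ho), zero_mul]

/-- `‖𝒦⁽⁴⁾_x‖ ≤ p^{−(5+E_x)}` for every class, and `≤ p^{−1}` for a single-pole class. -/
theorem padicNorm_classKU_le' (b : ℕ → ℤ) (hb : InPolytope b) (hp5 : 5 ≤ p) (hwin : (b 0 + 2 : ℤ) < (p : ℤ) ^ 2)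
    (x : ℕ) :
    padicNorm p (classKU b p x) ≤ (p : ℚ) ^ (-(5 + classExp b p x)) ∧
      (classPoleCount b p x = 1 → padicNorm p (classKU b p x) ≤ (p : ℚ) ^ (-(1 : ℤ))) := by
  have hterm : ∀ q ∈ classSet b p x, ∀ o ∈ range 6,
      padicNorm p (pfData b o q * ((taylorT4 p o ((q : ℤ) + 1) : ℚ) - if o = 4 then 1 else 0)) ≤
        (p : ℚ) ^ (-(5 + classExp b p x)) ∧
      (classPoleCount b p x = 1 → padicNorm p (pfData b o q * ((taylorT4 p o ((q : ℤ) + 1) : ℚ) - if o = 4 then 1 else 0))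
        ≤ (p : ℚ) ^ (-(1 : ℤ))) := by
    intro q hq o ho
    have ho' := mem_range.1 ho
    have hqn : q ≤ (b 0).toNat := ((mem_classSet_iff b x q).1 hq).1
    rw [padicNorm.mul]
    by_cases h0 : pfData b o q = 0
    · rw [h0, padicNorm.zero, zero_mul]; exact ⟨zpow_p_nonneg _, fun _ => zpow_p_nonneg _⟩
    have hw := padicNorm_weightU_le (p := p) hp5 ho' ((q : ℤ) + 1)
    have h1 : ((min o 3 : ℕ) : ℤ) ≤ o := by exact_mod_cast min_le_left _ _
    have h2 : ((min o 3 : ℕ) : ℤ) ≤ 3 := by exact_mod_cast min_le_right _ _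
    constructor
    · have hA := clusterBound_holds b p q o hb hp.out (by omega) hwin hqn ho' h0
      rw [classExp_eq_of_mem hq] at hA
      have hcn : padicNorm p (pfData b o q) ≤ (p : ℚ) ^ (-((o : ℤ) + 1 + classExp b p x)) := by
        rw [padicNorm.eq_zpow_of_nonzero h0]; exact zpow_le_zpow_right₀ one_le_p (by linarith)
      calc padicNorm p (pfData b o q) * _
          ≤ (p : ℚ) ^ (-((o : ℤ) + 1 + classExp b p x)) * (p : ℚ) ^ (-(4 - (min o 3 : ℕ) : ℤ)) :=
            mul_le_mul hcn hw (padicNorm.nonneg _) (zpow_p_nonneg _)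
        _ ≤ (p : ℚ) ^ (-(5 + classExp b p x)) := by
            rw [← zpow_add₀ (Nat.cast_ne_zero.2 hp.out.ne_zero)]
            exact zpow_le_zpow_right₀ one_le_p (by omega)
    · intro hc
      have hcq : classPoleCount b p q = 1 := by
        unfold classPoleCount; rw [classSet_eq_of_mem hq]; exact hc
      have hv := isolatedPoleIntegral_holds b p q o hb hp.out (by omega) hwin hqn ho' h0 hcq
      have hcn : padicNorm p (pfData b o q) ≤ 1 := by
        rw [padicNorm.eq_zpow_of_nonzero h0]; exact zpow_le_one_of_nonpos₀ one_le_p (by linarith)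
      calc padicNorm p (pfData b o q) * _ ≤ 1 * (p : ℚ) ^ (-(4 - (min o 3 : ℕ) : ℤ)) :=
            mul_le_mul hcn hw (padicNorm.nonneg _) zero_le_one
        _ ≤ (p : ℚ) ^ (-(1 : ℤ)) := by rw [one_mul]; exact zpow_le_zpow_right₀ one_le_p (by omega)
  refine ⟨?_, fun hc => ?_⟩
  · unfold classKU
    exact padicNorm.sum_le' (fun q hq => padicNorm.sum_le' (fun o ho => (hterm q hq o ho).1) (zpow_p_nonneg _))
      (zpow_p_nonneg _)
  · unfold classKU
    exact padicNorm.sum_le' (fun q hq => padicNorm.sum_le' (fun o ho => (hterm q hq o ho).2 hc) (zpow_p_nonneg _))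
      (zpow_p_nonneg _)

/-! ### The three bounds -/

/-- **`v_p(W(b)) ≥ wLB(b,p)`** for every window prime. -/
theorem wLB_le_padicValRat_coeffW (b : ℕ → ℤ) (hb : InPolytope b) (hp5 : 5 ≤ p) (hwin : (b 0 + 2 : ℤ) < (p : ℤ) ^ 2)
    (hW : coeffW b ≠ 0) : wLB b p ≤ padicValRat p (coeffW b) := by
  set w := wLB b p with hw
  -- every class row is bounded by `p^{-w}`
  have hrow : ∀ x ∈ range p, padicNorm p (classK b p x) ≤ (p : ℚ) ^ (-w) := by
    intro x hx
    have hx' := mem_range.1 hx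
    rcases Nat.lt_trichotomy (classPoleCount b p x) 1 with hc | hc | hc
    · rw [classK_eq_zero_of_noPole b hb (by omega), padicNorm.zero]; exact zpow_p_nonneg _
    · have hle : w ≤ 1 := by
        rw [hw, wLB]; exact getD_min_le (List.mem_append.2 (Or.inl (mem_classRowList b 3 hx' (by rw [if_pos hc]))))
      exact (padicNorm_classK_le_single b hb hp5 hwin hx' hc).trans (zpow_le_zpow_right₀ one_le_p (by linarith))
    · have hle : w ≤ 3 + classExp b p x := by
        rw [hw, wLB]
        exact getD_min_le (List.mem_append.2 (Or.inl (mem_classRowList b 3 hx' (by rw [if_neg (by omega), if_pos (by omega)]))))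
      exact (padicNorm_classK_le_multi b hb hp5 hwin hx' (by omega)).trans (zpow_le_zpow_right₀ one_le_p (by linarith))
  have hK : padicNorm p (kRes b p) ≤ (p : ℚ) ^ (-w) := by
    rw [kRes_eq_sum_classK b hp.out.pos]; exact padicNorm.sum_le' hrow (zpow_p_nonneg _)
  apply val_ge_of_padicNorm_le hW
  rw [coeffW_eq_omegaRes_sub_kRes b p]
  by_cases hpd : (p : ℤ) ≤ dOf b + 1
  · rw [omegaRes_eq_zero b hb hpd, zero_sub, padicNorm.neg]; exact hK
  · have hle : w ≤ 0 := by
      rw [hw, wLB]; exact getD_min_le (List.mem_append.2 (Or.inr (by rw [if_pos (by omega)]; simp)))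
    refine (padicNorm.sub (p := p)).trans (max_le ?_ hK)
    exact (padicNorm_omegaRes_le_one b hb (by omega)).trans (by simpa using zpow_le_zpow_right₀ one_le_p (neg_nonneg.2 hle))

/-- **`v_p(U(b)) ≥ uLB(b,p)`** for every window prime. -/
theorem uLB_le_padicValRat_coeffU (b : ℕ → ℤ) (hb : InPolytope b) (hp5 : 5 ≤ p) (hwin : (b 0 + 2 : ℤ) < (p : ℤ) ^ 2)
    (hU : coeffU b ≠ 0) : uLB b p ≤ padicValRat p (coeffU b) := by
  set w := uLB b p with hw
  have hrow : ∀ x ∈ range p, padicNorm p (classKU b p x) ≤ (p : ℚ) ^ (-w) := by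
    intro x hx
    have hx' := mem_range.1 hx
    rcases Nat.lt_trichotomy (classPoleCount b p x) 1 with hc | hc | hc
    · rw [classKU_eq_zero_of_noPole b hb (by omega), padicNorm.zero]; exact zpow_p_nonneg _
    · have hle : w ≤ 1 := by
        rw [hw, uLB]; exact getD_min_le (List.mem_append.2 (Or.inl (mem_classRowList b 5 hx' (by rw [if_pos hc]))))
      exact ((padicNorm_classKU_le' b hb hp5 hwin x).2 hc).trans (zpow_le_zpow_right₀ one_le_p (by linarith))
    · have hle : w ≤ 5 + classExp b p x := by
        rw [hw, uLB]
        exact getD_min_le (List.mem_append.2 (Or.inl (mem_classRowList b 5 hx' (by rw [if_neg (by omega), if_pos (by omega)]))))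
      exact (padicNorm_classKU_le' b hb hp5 hwin x).1.trans (zpow_le_zpow_right₀ one_le_p (by linarith))
  have hK : padicNorm p (kResU b p) ≤ (p : ℚ) ^ (-w) := by
    rw [kResU_eq_sum_classKU b hp.out.pos]; exact padicNorm.sum_le' hrow (zpow_p_nonneg _)
  apply val_ge_of_padicNorm_le hU
  rw [coeffU_eq_omegaResU_sub_kResU b p]
  by_cases hpd : 4 * (p : ℤ) ≤ 2 * dOf b + 3
  · rw [omegaResU_eq_zero b hb hpd, zero_sub, padicNorm.neg]; exact hK
  · have hle : w ≤ 0 := by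
      rw [hw, uLB]; exact getD_min_le (List.mem_append.2 (Or.inr (by rw [if_pos (by omega)]; simp)))
    refine (padicNorm.sub (p := p)).trans (max_le ?_ hK)
    exact (padicNorm_omegaResU_le_one b hb (by omega)).trans (by simpa using zpow_le_zpow_right₀ one_le_p (neg_nonneg.2 hle))

/-- **`v_p(V(b)) ≥ VB(b,p)`**: the minimum of the `ν_x` over the pole classes bounds the constant term. -/
theorem vbMin_le_padicValRat_coeffV (b : ℕ → ℤ) (hb : InPolytope b) (hp5 : 5 ≤ p) (hwin : (b 0 + 2 : ℤ) < (p : ℤ) ^ 2)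
    {v : ℤ} (hv : vbMin b p = some v) (hV : coeffV b ≠ 0) : v ≤ padicValRat p (coeffV b) :=
  val_ge_of_padicNorm_le hV (padicNorm_coeffV_le b hb hp5 hwin v fun _ hx hpole => vbMin_le b hv hx hpole)

end Summit.KontsevichZagierPeriods.Zeta5Search.ClusterValuation

end
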